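import Summits.CriticalPhenomena.PercolationContinuityZ3.Theorems.PercNearOneGluingNoHeavyLowerTailSahiOneStepUniformThreshold
import HarnessLib

/-!
# Two-sided lumping — the hull generated below a level (dual of `H`-generation)

Support file (prover prim-ineq-prove-3 gen 50; `--supports stmt-CriticalPhenomena-4575`; memo
`run/shared/lean/prim/prim-ineq-prove-3/FINDING-G50-TWO-SIDED-LUMPING.md`, §2.2 (c),(d)).  No definitions, no named facts, no sorries, no `native_decide`.

For an event `B` and a region `D` (in the application `D = {ω | #(G ∩ ω) < s}`, the complement of the upper ball) the **hull generated inside `D`**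
is `{ω | ∃ z ⊆ ω, z ∈ B ∧ z ∈ D}` — the smallest increasing event with the same trace on `D` as `B` (the order dual of gen 21's `H`-generated hull
`{ω | ∀ ω' ⊇ ω, ω' ∈ H → ω' ∈ B}`).  This file proves the bookkeeping the two-sided lumping theorem needs: it is increasing, inside `B`, has the
same trace on `D`, is `G`-determined, is generated below `s` in the sense of `upperDrift_nonpos_of_dominated` (`genBelow_genb`), preserves
`e`-domination (`dominated_genb`) and preserves `H`-generation when `Dᶜ ⊆ H` (`hgen_genb`).
-/

noncomputable section

namespace Summit.CriticalPhenomena.PercolationContinuityZ3.Theorems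

namespace SahiOneStep

open MeasureTheory Finset
open Literature.Probability.Percolation (DeterminedBy determinedBy_iff)
open Literature.Probability.LatticeModels (prodBernoulli)
open scoped Classical

variable {ι : Type*} [Fintype ι]

omit [Fintype ι] in
/-- The hull generated inside `D` is increasing. [this work] -/
theorem isUpperSet_genb (B D : Set (Set ι)) : IsUpperSet {ω : Set ι | ∃ z : Set ι, z ⊆ ω ∧ z ∈ B ∧ z ∈ D} :=
  fun _ _ h12 ⟨z, hz, hzB, hzD⟩ => ⟨z, hz.trans h12, hzB, hzD⟩

omit [Fintype ι] in
/-- The hull generated inside `D` lies inside the (increasing) event. [this work] -/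
theorem genb_subset {B : Set (Set ι)} (hB : IsUpperSet B) (D : Set (Set ι)) :
    {ω : Set ι | ∃ z : Set ι, z ⊆ ω ∧ z ∈ B ∧ z ∈ D} ⊆ B :=
  fun _ ⟨_, hz, hzB, _⟩ => hB hz hzB

omit [Fintype ι] in
/-- Members of `B ∩ D` lie in the hull. [this work] -/
theorem mem_genb_of_mem {B D : Set (Set ι)} {ω : Set ι} (hωB : ω ∈ B) (hωD : ω ∈ D) :
    ω ∈ {ω : Set ι | ∃ z : Set ι, z ⊆ ω ∧ z ∈ B ∧ z ∈ D} :=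
  ⟨ω, subset_rfl, hωB, hωD⟩

omit [Fintype ι] in
/-- The hull has the same trace on `D` as the event. [this work] -/
theorem inter_genb_eq {B : Set (Set ι)} (hB : IsUpperSet B) (D : Set (Set ι)) :
    D ∩ {ω : Set ι | ∃ z : Set ι, z ⊆ ω ∧ z ∈ B ∧ z ∈ D} = D ∩ B := by
  ext ω
  constructor
  · rintro ⟨hD, hg⟩
    exact ⟨hD, genb_subset hB D hg⟩
  · rintro ⟨hD, hωB⟩
    exact ⟨hD, mem_genb_of_mem hωB hD⟩

omit [Fintype ι] in
/-- For any `X ⊆ D` the hull has the same trace on `X` as the event. [this work] -/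
theorem inter_genb_eq_of_subset {B : Set (Set ι)} (hB : IsUpperSet B) {D X : Set (Set ι)} (hXD : X ⊆ D) :
    X ∩ {ω : Set ι | ∃ z : Set ι, z ⊆ ω ∧ z ∈ B ∧ z ∈ D} = X ∩ B := by
  ext ω
  constructor
  · rintro ⟨hX, hg⟩
    exact ⟨hX, genb_subset hB D hg⟩
  · rintro ⟨hX, hωB⟩
    exact ⟨hX, mem_genb_of_mem hωB (hXD hX)⟩

omit [Fintype ι] in
/-- The hull (inside the sub-level region `{#(G ∩ ω) < s}`) of a `G`-determined event is `G`-determined. [this work] -/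
theorem determinedBy_genb {G : Finset ι} {B : Set (Set ι)} (hBG : DeterminedBy B (↑G : Set ι)) (s : ℕ) :
    DeterminedBy {ω : Set ι | ∃ z : Set ι, z ⊆ ω ∧ z ∈ B ∧ z ∈ {ω : Set ι | (G.filter (· ∈ ω)).card < s}} (↑G : Set ι) := by
  rw [determinedBy_iff] at hBG ⊢
  -- it suffices to prove one direction for every pair
  suffices h : ∀ ω ω' : Set ι, ω ∩ ↑G = ω' ∩ ↑G →
      ω ∈ {ω : Set ι | ∃ z : Set ι, z ⊆ ω ∧ z ∈ B ∧ z ∈ {ω : Set ι | (G.filter (· ∈ ω)).card < s}} →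
      ω' ∈ {ω : Set ι | ∃ z : Set ι, z ⊆ ω ∧ z ∈ B ∧ z ∈ {ω : Set ι | (G.filter (· ∈ ω)).card < s}} from
    fun ω ω' hωω' => ⟨h ω ω' hωω', h ω' ω hωω'.symm⟩
  rintro ω ω' hωω' ⟨z, hz, hzB, hzD⟩
  refine ⟨z ∩ ↑G, ?_, ?_, ?_⟩
  · intro x hx
    have hx' : x ∈ ω ∩ ↑G := ⟨hz hx.1, hx.2⟩
    rw [hωω'] at hx'
    exact hx'.1
  · have hzz : z ∩ ↑G = (z ∩ ↑G) ∩ ↑G := by rw [Set.inter_assoc, Set.inter_self]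
    exact (hBG z (z ∩ ↑G) hzz).1 hzB
  · simp only [Set.mem_setOf_eq] at hzD ⊢
    rw [Finset.filter_congr_decidable G (· ∈ z ∩ (↑G : Set ι)) _]
    refine lt_of_le_of_lt (Finset.card_le_card fun i hi => ?_) hzD
    rw [Finset.mem_filter] at hi ⊢
    exact ⟨hi.1, hi.2.1⟩

omit [Fintype ι] in
/-- The hull is **generated below `r+1`**: every member contains a member `z` with `#(G ∩ z) ≤ r` (the hypothesis of
`upperDrift_nonpos_of_dominated`). [this work] -/
theorem genBelow_genb (G : Finset ι) (B : Set (Set ι)) (r : ℕ) :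
    ∀ ω ∈ {ω : Set ι | ∃ z : Set ι, z ⊆ ω ∧ z ∈ B ∧ z ∈ {ω : Set ι | (G.filter (· ∈ ω)).card < r + 1}},
      ∃ z ∈ {ω : Set ι | ∃ z : Set ι, z ⊆ ω ∧ z ∈ B ∧ z ∈ {ω : Set ι | (G.filter (· ∈ ω)).card < r + 1}},
        z ⊆ ω ∧ (G.filter (· ∈ z)).card ≤ r := by
  rintro ω ⟨z, hz, hzB, hzD⟩
  refine ⟨z, mem_genb_of_mem hzB hzD, hz, ?_⟩
  simp only [Set.mem_setOf_eq] at hzD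
  omega

omit [Fintype ι] in
/-- **`H`-generation survives the hull**: if `B` is `H`-generated and the complement of `D` lies inside `H`, the hull generated inside `D` is
again `H`-generated. [this work] -/
theorem hgen_genb {H D B : Set (Set ι)} (hB : IsUpperSet B) (hDH : Dᶜ ⊆ H)
    (hgen : ∀ ω : Set ι, (∀ ω' : Set ι, ω ⊆ ω' → ω' ∈ H → ω' ∈ B) → ω ∈ B) :
    ∀ ω : Set ι, (∀ ω' : Set ι, ω ⊆ ω' → ω' ∈ H → ω' ∈ {ω : Set ι | ∃ z : Set ι, z ⊆ ω ∧ z ∈ B ∧ z ∈ D}) →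
      ω ∈ {ω : Set ι | ∃ z : Set ι, z ⊆ ω ∧ z ∈ B ∧ z ∈ D} := by
  intro ω hω
  have hωB : ω ∈ B := hgen ω fun ω' h1 h2 => genb_subset hB D (hω ω' h1 h2)
  by_cases hωD : ω ∈ D
  · exact mem_genb_of_mem hωB hωD
  · exact hω ω subset_rfl (hDH hωD)

omit [Fintype ι] in
/-- **`e`-domination survives the hull** (generated below `s` in the block `G ∋ e, j`): if every `j`-trade of a member of `B` containing `e`
stays in `B`, the same holds for the hull. [this work] -/
theorem dominated_genb {e j : ι} {G : Finset ι} (he : e ∈ G) (hj : j ∈ G) (s : ℕ) {B : Set (Set ι)}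
    (hdom : ∀ ω ∈ B, e ∈ ω → j ∉ ω → (ω \ {e}) ∪ {j} ∈ B) :
    ∀ ω ∈ {ω : Set ι | ∃ z : Set ι, z ⊆ ω ∧ z ∈ B ∧ z ∈ {ω : Set ι | (G.filter (· ∈ ω)).card < s}},
      e ∈ ω → j ∉ ω → (ω \ {e}) ∪ {j} ∈ {ω : Set ι | ∃ z : Set ι, z ⊆ ω ∧ z ∈ B ∧ z ∈ {ω : Set ι | (G.filter (· ∈ ω)).card < s}} := by
  rintro ω ⟨z, hz, hzB, hzD⟩ heω hjω
  have hjz : j ∉ z := fun h => hjω (hz h)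
  by_cases hez : e ∈ z
  · -- trade `e` for `j` inside the generator
    refine ⟨(z \ {e}) ∪ {j}, ?_, hdom z hzB hez hjz, ?_⟩
    · rintro x (⟨hxz, hxe⟩ | hxj)
      · exact Or.inl ⟨hz hxz, hxe⟩
      · exact Or.inr hxj
    · simp only [Set.mem_setOf_eq] at hzD ⊢
      rw [Finset.filter_congr_decidable G (· ∈ (z \ {e}) ∪ {j}) _, card_filter_trade he hj hez hjz]
      rwa [Finset.filter_congr_decidable G (· ∈ z) _] at hzD
  · refine ⟨z, ?_, hzB, hzD⟩
    intro x hxz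
    exact Or.inl ⟨hz hxz, fun hxe => hez (hxe ▸ hxz)⟩

/-! ## Thresholds: nesting and the full configuration -/

omit [Fintype ι] in
/-- Upper balls are nested. [folklore] -/
theorem threshold_subset_threshold (G : Finset ι) {t s : ℕ} (hts : t ≤ s) :
    {ω : Set ι | s ≤ (G.filter (· ∈ ω)).card} ⊆ {ω : Set ι | t ≤ (G.filter (· ∈ ω)).card} :=
  fun _ h => le_trans hts h

omit [Fintype ι] in
/-- A nonempty increasing `G`-determined event contains every configuration containing all of `G`. [folklore] -/
theorem threshold_card_subset {G : Finset ι} {A : Set (Set ι)} (hA : IsUpperSet A) (hAG : DeterminedBy A (↑G : Set ι))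
    (hne : A.Nonempty) : {ω : Set ι | G.card ≤ (G.filter (· ∈ ω)).card} ⊆ A := by
  intro ω hω
  obtain ⟨a, ha⟩ := hne
  have hGω : ∀ i ∈ G, i ∈ ω := by
    have heq : G.filter (· ∈ ω) = G := Finset.eq_of_subset_of_card_le (Finset.filter_subset _ _) hω
    intro i hi
    rw [← heq] at hi
    exact (Finset.mem_filter.1 hi).2
  have h1 : ω ∪ a ∈ A := hA Set.subset_union_right ha
  rw [determinedBy_iff] at hAG
  refine (hAG ω (ω ∪ a) ?_).2 h1
  ext i
  simp only [Set.mem_inter_iff, Set.mem_union, Finset.mem_coe]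
  constructor
  · rintro ⟨hi, hiG⟩; exact ⟨Or.inl hi, hiG⟩
  · rintro ⟨_, hiG⟩; exact ⟨hGω i hiG, hiG⟩

omit [Fintype ι] in
/-- An upper ball of level `≤ #G` has positive probability when the densities on `G` lie in `(0,1)`. [folklore] -/
theorem real_threshold_pos (p : ι → unitInterval) (G : Finset ι) (hp : ∀ i ∈ G, 0 < (p i : ℝ) ∧ (p i : ℝ) < 1) {s : ℕ}
    (hs : s ≤ G.card) : 0 < (prodBernoulli p).real {ω : Set ι | s ≤ (G.filter (· ∈ ω)).card} :=
  lt_of_lt_of_le (real_layer_pos p G hp hs)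
    (measureReal_mono (fun ω (h : (G.filter (· ∈ ω)).card = s) => by simp only [Set.mem_setOf_eq]; omega))

end SahiOneStep

end Summit.CriticalPhenomena.PercolationContinuityZ3.Theorems
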